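import Literature.AlgebraicGeometry.Resolution.AffineBlowupAlgebra
import Mathlib.Algebra.Group.Pointwise.Set.BigOperators
import HarnessLib

/-!
# The affine blowup algebra of a product of ideals: `R[(∏ Jᵢ)/(∏ aᵢ)]` is generated by the `t/aᵢ`

Topic: `Literature/AlgebraicGeometry/Resolution`. For ideals `J₁, …, J_k` of a commutative ring `R`
and elements `aᵢ ∈ Jᵢ`, the chart of the blow-up of `Spec R` along the PRODUCT `J = ∏ Jᵢ` over
the product `g = ∏ aᵢ` has coordinate ring the affine blowup algebra `R[J/g] ⊆ R[1/g]` (image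
model `blowupAlgebra` of `AffineBlowupAlgebra.lean`). This file PROVES that it is generated over
`R` by the elements

  `t · (∏_{j ≠ i} a_j) / (∏_j a_j)`  (`= t / aᵢ` in `R[1/g]`),  `t ∈ Jᵢ` (or `t` in a generating set of `Jᵢ`),

i.e. `R[J/g] = R[J₁/a₁, …, J_k/a_k]` inside `R[1/g]` (`blowupAlgebra_prod_span_eq_adjoin`,
`blowupAlgebra_prod_eq_adjoin`), and hence is the image of a polynomial ring on symbols
`ξ_{i,t}` (`range_prodChartEval`). Since the blow-up in a product of finitely generated ideals is
the composite of the blow-ups in the factors (Stacks 080A; `BlowupsProduct.lean`), these are the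
charts of an iterated blow-up, or — the use intended here — of the closure of the graph of a
product of rational maps to projective spaces: in Y. Hu, *Universal characteristic-free resolution
of singularities, I* (arXiv:2507.21400), §4.1, the singular model `𝒱 ⊆ 𝕌 × ∏_F ℙ_F` is the closure
of the graph of `x ↦ ([x_{u_s} x_{v_s}]_{s ∈ S_F})_F`, and its standard chart over
`(x_{(u_{o_F}, v_{o_F})} ≠ 0 ∀ F)` is `Spec` of the `R`-algebra generated by the de-homogenised
`𝔯`-variables `x_{u_s}x_{v_s} / x_{u_{o_F}}x_{v_{o_F}}` — the algebra computed here for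
`J_F = (x_{u_s}x_{v_s} : s ∈ S_F)`, `a_F = x_{u_{o_F}}x_{v_{o_F}}`.

* `prodChartGen s a i t` — the element `t · (∏_{j ∈ s ∖ i} a_j) / ∏_{j ∈ s} a_j` of `R[1/∏ a]`;
  `prodChartGen_mul_algebraMap` (`· aᵢ = t`), `prodChartGen_self` (`t = aᵢ` gives `1`),
  `prodChartGen_mem_blowupAlgebra`, `prod_prodChartGen` (`∏ᵢ (xᵢ/aᵢ) = (∏ xᵢ)/(∏ aᵢ)`);
* `blowupAlgebra_prod_span_eq_adjoin` — **`R[(∏ span Tᵢ)/(∏ aᵢ)] = R[t/aᵢ : t ∈ Tᵢ, i]`** for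
  `aᵢ ∈ Tᵢ`; `blowupAlgebra_prod_eq_adjoin` — the same with `Tᵢ = Jᵢ`;
* `prodChartEval`, `range_prodChartEval` — the surjection `R[ξ_{i,k}] ↠ R[(∏ Jᵢ)/(∏ aᵢ)]`,
  `ξ_{i,k} ↦ x_{i,k}/aᵢ`, for `Jᵢ = (aᵢ, x_{i,k} : k)`.

Everything is proved; no named facts (D-0026).

## References

* The Stacks Project, Tags 052P, 052Q (affine blowup algebras), Tag 080A (blowing up in a
  product of ideals). [StacksProject]
* Y. Hu, *Universal Characteristic-free Resolution of Singularities, I*, arXiv:2507.21400 (2025),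
  §4.1 and §5 Def. 5.1 (the model `𝒱` and its standard charts; theorem numbers of the arXiv v1
  TeX source). [Hu2025]
-/

noncomputable section

open IsLocalization

namespace Literature.AlgebraicGeometry.Resolution

universe u v w

variable {R : Type u} [CommRing R] {ι : Type v} [DecidableEq ι] (s : Finset ι) (a : ι → R)

/-! ### The generators `t/aᵢ` written over the common denominator `∏ aⱼ` -/

/-- **The generator `t · (∏_{j ∈ s ∖ i} a_j) / ∏_{j ∈ s} a_j`** of the chart ring over `∏ a_j`
(`= t/aᵢ`; for Hu's `𝒱`: the de-homogenised `𝔯`-variable `x_{u_s}x_{v_s}/x_{u_o}x_{v_o}`).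
[cite: StacksProject, Tag 052P] -/
def prodChartGen (i : ι) (t : R) : Localization.Away (∏ j ∈ s, a j) :=
  algebraMap R (Localization.Away (∏ j ∈ s, a j)) (t * ∏ j ∈ s.erase i, a j) *
    Away.invSelf (∏ j ∈ s, a j)

/-- `(t/aᵢ) · aᵢ = t`: `prodChartGen s a i t · aᵢ = t/1`. [folklore] -/
theorem prodChartGen_mul_algebraMap {i : ι} (hi : i ∈ s) (t : R) :
    prodChartGen s a i t * algebraMap R (Localization.Away (∏ j ∈ s, a j)) (a i) =
      algebraMap R (Localization.Away (∏ j ∈ s, a j)) t := by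
  rw [prodChartGen, mul_assoc, mul_comm (Away.invSelf _), ← mul_assoc, ← map_mul, mul_assoc,
    Finset.prod_erase_mul _ _ hi, map_mul, mul_assoc, Away.mul_invSelf, mul_one]

/-- `aᵢ/aᵢ = 1`. [folklore] -/
theorem prodChartGen_self {i : ι} (hi : i ∈ s) :
    prodChartGen s a i (a i) = 1 := by
  rw [prodChartGen, Finset.mul_prod_erase _ _ hi, Away.mul_invSelf]

/-- `t/aᵢ` is `R`-linear in `t`. [folklore] -/
theorem prodChartGen_add (i : ι) (t t' : R) :
    prodChartGen s a i (t + t') = prodChartGen s a i t + prodChartGen s a i t' := by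
  simp only [prodChartGen, add_mul, map_add]

/-- `(r t)/aᵢ = r · (t/aᵢ)`. [folklore] -/
theorem prodChartGen_mul_left (i : ι) (r t : R) :
    prodChartGen s a i (r * t) =
      algebraMap R (Localization.Away (∏ j ∈ s, a j)) r * prodChartGen s a i t := by
  simp only [prodChartGen, mul_assoc, map_mul]

/-- `0/aᵢ = 0`. [folklore] -/
@[simp] theorem prodChartGen_zero (i : ι) : prodChartGen s a i 0 = 0 := by
  simp [prodChartGen]

/-- **`t/aᵢ ∈ R[(∏ Jⱼ)/(∏ aⱼ)]`** for `t ∈ Jᵢ` and `aⱼ ∈ Jⱼ`: indeed `t · ∏_{j ≠ i} a_j ∈ ∏_j J_j`.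
[cite: StacksProject, Tag 052P] -/
theorem prodChartGen_mem_blowupAlgebra (J : ι → Ideal R) (ha : ∀ j ∈ s, a j ∈ J j)
    {i : ι} (hi : i ∈ s) {t : R} (ht : t ∈ J i) :
    prodChartGen s a i t ∈ blowupAlgebra (∏ j ∈ s, J j) (∏ j ∈ s, a j) := by
  refine div_mem_blowupAlgebra _ _ ?_
  have hprod : (t * ∏ j ∈ s.erase i, a j) = ∏ j ∈ s, Function.update a i t j := by
    rw [← Finset.mul_prod_erase s (Function.update a i t) hi, Function.update_self]
    congr 1
    exact Finset.prod_congr rfl fun j hj => by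
      rw [Function.update_of_ne (Finset.ne_of_mem_erase hj)]
  rw [hprod]
  exact Ideal.prod_mem_prod fun j hj => by
    by_cases hji : j = i
    · subst hji
      rwa [Function.update_self]
    · rw [Function.update_of_ne hji]
      exact ha j hj

/-- **`∏ᵢ (xᵢ/aᵢ) = (∏ᵢ xᵢ)/(∏ᵢ aᵢ)`**: the product of the generators attached to a choice of
`xᵢ ∈ Jᵢ` is the basic fraction `(∏ xᵢ)/g` (both sides become `∏ xᵢ` after multiplication by the
unit `g/1` of `R[1/g]`). [folklore] -/
theorem prod_prodChartGen (x : ι → R) :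
    ∏ i ∈ s, prodChartGen s a i (x i) =
      algebraMap R (Localization.Away (∏ j ∈ s, a j)) (∏ i ∈ s, x i) *
        Away.invSelf (∏ j ∈ s, a j) := by
  have hunit : IsUnit (algebraMap R (Localization.Away (∏ j ∈ s, a j)) (∏ j ∈ s, a j)) :=
    IsLocalization.Away.algebraMap_isUnit _
  have h1 : (∏ i ∈ s, prodChartGen s a i (x i)) *
      algebraMap R (Localization.Away (∏ j ∈ s, a j)) (∏ j ∈ s, a j) =
        algebraMap R (Localization.Away (∏ j ∈ s, a j)) (∏ i ∈ s, x i) := by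
    rw [map_prod (algebraMap R (Localization.Away (∏ j ∈ s, a j))) a s, ← Finset.prod_mul_distrib,
      map_prod]
    exact Finset.prod_congr rfl fun i hi => prodChartGen_mul_algebraMap s a hi (x i)
  have h2 : algebraMap R (Localization.Away (∏ j ∈ s, a j)) (∏ i ∈ s, x i) *
      Away.invSelf (∏ j ∈ s, a j) *
        algebraMap R (Localization.Away (∏ j ∈ s, a j)) (∏ j ∈ s, a j) =
        algebraMap R (Localization.Away (∏ j ∈ s, a j)) (∏ i ∈ s, x i) := by
    rw [mul_assoc, mul_comm (Away.invSelf _), Away.mul_invSelf, mul_one]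
  exact hunit.mul_left_injective (h1.trans h2.symm)

/-! ### `R[(∏ Jᵢ)/(∏ aᵢ)] = R[t/aᵢ : t ∈ Jᵢ]` -/

/-- **The affine blowup algebra of a product of ideals is generated by the `t/aᵢ`**, `t` running
through generating sets: for sets `Tᵢ ∋ aᵢ`,
`R[(∏ᵢ span Tᵢ)/(∏ᵢ aᵢ)] = R[t · ∏_{j≠i} aⱼ / ∏ⱼ aⱼ : t ∈ Tᵢ, i ∈ s]` inside `R[1/∏ aᵢ]`
(the chart over `∏ aᵢ` of the blow-up in `∏ Jᵢ` has the coordinates of the charts over `aᵢ` of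
the blow-ups in the `Jᵢ`). [cite: StacksProject, Tag 052P and Tag 080A] -/
theorem blowupAlgebra_prod_span_eq_adjoin (T : ι → Set R) (ha : ∀ i ∈ s, a i ∈ T i) :
    blowupAlgebra (∏ i ∈ s, Ideal.span (T i)) (∏ i ∈ s, a i) =
      Algebra.adjoin R (⋃ i ∈ s, prodChartGen s a i '' T i) := by
  apply le_antisymm
  · -- every `y/g`, `y ∈ ∏ span Tᵢ = span (∏ Tᵢ)`, is a combination of products `∏ (tᵢ/aᵢ)`
    refine Algebra.adjoin_le ?_
    rintro _ ⟨y, hy, rfl⟩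
    rw [Ideal.prod_span] at hy
    refine Submodule.span_induction (p := fun y _ =>
      algebraMap R (Localization.Away (∏ j ∈ s, a j)) y * Away.invSelf (∏ j ∈ s, a j) ∈
        Algebra.adjoin R (⋃ i ∈ s, prodChartGen s a i '' T i)) ?_ ?_ ?_ ?_ hy
    · intro y hy
      obtain ⟨x, hx, rfl⟩ := (Set.mem_finsetProd s T y).mp hy
      rw [← prod_prodChartGen s a x]
      exact Subalgebra.prod_mem _ fun i hi =>
        Algebra.subset_adjoin (Set.mem_biUnion hi ⟨x i, hx hi, rfl⟩)
    · rw [map_zero, zero_mul]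
      exact Subalgebra.zero_mem _
    · intro y z _ _ hy hz
      rw [map_add, add_mul]
      exact Subalgebra.add_mem _ hy hz
    · intro r y _ hy
      rw [smul_eq_mul, map_mul, mul_assoc]
      exact Subalgebra.mul_mem _ (Subalgebra.algebraMap_mem _ r) hy
  · refine Algebra.adjoin_le ?_
    intro z hz
    obtain ⟨i, hi, t, ht, rfl⟩ : ∃ i ∈ s, ∃ t ∈ T i, prodChartGen s a i t = z := by
      simpa only [Set.mem_iUnion, Set.mem_image, exists_prop] using hz
    exact prodChartGen_mem_blowupAlgebra s a (fun i => Ideal.span (T i))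
      (fun j hj => Ideal.subset_span (ha j hj)) hi (Ideal.subset_span ht)

/-- **`R[(∏ Jᵢ)/(∏ aᵢ)] = R[J₁/a₁, …, J_k/a_k]`**: the affine blowup algebra of the product is
generated by the `t/aᵢ`, `t ∈ Jᵢ` (`aᵢ ∈ Jᵢ`). [cite: StacksProject, Tag 052P and Tag 080A] -/
theorem blowupAlgebra_prod_eq_adjoin (J : ι → Ideal R) (ha : ∀ i ∈ s, a i ∈ J i) :
    blowupAlgebra (∏ i ∈ s, J i) (∏ i ∈ s, a i) =
      Algebra.adjoin R (⋃ i ∈ s, prodChartGen s a i '' (J i : Set R)) := by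
  have h := blowupAlgebra_prod_span_eq_adjoin s a (fun i => (J i : Set R)) ha
  simpa only [Ideal.span_eq] using h

/-! ### The polynomial presentation `R[ξ_{i,k}] ↠ R[(∏ Jᵢ)/(∏ aᵢ)]` -/

section Presentation

variable {κ : ι → Type w} (x : ∀ i, κ i → R)

/-- The ideals `Jᵢ = (aᵢ, x_{i,k} : k)` generated by `aᵢ` and a family `x i`. [folklore] -/
abbrev prodChartIdeal (i : ι) : Ideal R := Ideal.span (insert (a i) (Set.range (x i)))

/-- **The chart presentation** `R[ξ_{i,k} : i ∈ s, k] → R[1/∏ aᵢ]`, `ξ_{i,k} ↦ x_{i,k}/aᵢ` (for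
Hu's `𝒱`: the de-homogenised `𝔯`-variables of the standard chart `(ξ_{F,o_F} ≡ 1 ∀ F)` evaluated
on the graph). [cite: Hu2025, §4.1 and §5 Def. 5.1] -/
def prodChartEval : MvPolynomial (Σ i : s, κ i) R →ₐ[R] Localization.Away (∏ j ∈ s, a j) :=
  MvPolynomial.aeval fun ik => prodChartGen s a ik.1 (x ik.1 ik.2)

/-- `prodChartEval` on a variable. [folklore] -/
@[simp] theorem prodChartEval_X (ik : Σ i : s, κ i) :
    prodChartEval s a x (MvPolynomial.X ik) = prodChartGen s a ik.1 (x ik.1 ik.2) := by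
  simp [prodChartEval]

/-- **The image of the chart presentation is exactly the affine blowup algebra
`R[(∏ Jᵢ)/(∏ aᵢ)]`**, `Jᵢ = (aᵢ, x_{i,k} : k)`: the chart of the blow-up in `∏ Jᵢ` over `∏ aᵢ` is
a closed subscheme of the affine space `Spec R[ξ_{i,k}]` (the generator `aᵢ/aᵢ = 1` being
redundant). [cite: StacksProject, Tag 052P and Tag 080A] [cite: Hu2025, §4.1] -/
theorem range_prodChartEval :
    (prodChartEval s a x).range =
      blowupAlgebra (∏ i ∈ s, prodChartIdeal a x i) (∏ i ∈ s, a i) := by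
  rw [prodChartEval, ← Algebra.adjoin_range_eq_range_aeval,
    blowupAlgebra_prod_span_eq_adjoin s a _ (fun i _ => Set.mem_insert _ _)]
  apply le_antisymm
  · refine Algebra.adjoin_mono ?_
    rintro _ ⟨⟨⟨i, hi⟩, k⟩, rfl⟩
    exact Set.mem_biUnion hi ⟨x i k, Set.mem_insert_of_mem _ ⟨k, rfl⟩, rfl⟩
  · refine Algebra.adjoin_le ?_
    intro z hz
    obtain ⟨i, hi, t, ht, rfl⟩ : ∃ i ∈ s, ∃ t ∈ insert (a i) (Set.range (x i)),
        prodChartGen s a i t = z := by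
      simpa only [Set.mem_iUnion, Set.mem_image, exists_prop] using hz
    rcases Set.mem_insert_iff.mp ht with rfl | ⟨k, rfl⟩
    · rw [prodChartGen_self s a hi]
      exact Subalgebra.one_mem _
    · exact Algebra.subset_adjoin ⟨⟨⟨i, hi⟩, k⟩, rfl⟩

/-- Pointwise surjectivity: every element of `R[(∏ Jᵢ)/(∏ aᵢ)]` is a polynomial in the `x_{i,k}/aᵢ`.
[cite: StacksProject, Tag 052P] -/
theorem exists_prodChartEval_eq {z : Localization.Away (∏ j ∈ s, a j)}
    (hz : z ∈ blowupAlgebra (∏ i ∈ s, prodChartIdeal a x i) (∏ i ∈ s, a i)) :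
    ∃ p : MvPolynomial (Σ i : s, κ i) R, prodChartEval s a x p = z := by
  rw [← range_prodChartEval s a x] at hz
  exact hz

end Presentation

end Literature.AlgebraicGeometry.Resolution

end
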